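import Summits.ABC.IUTFork.Repair.RHSigmaStrataEq
import Summits.ABC.IUTFork.Cor312ThetaSideClosedK
import Summits.ABC.IUTFork.Repair.RHHullCapacityNecessaryTyped
import Summits.ABC.IUTFork.Repair.RHOffSigmaTolerance
import HarnessLib

/-!
# R-H ROUND 2, Q2 rows 3/4 AT THE GENUINE `K`-LEVEL DATUM: «Cor. 3.12 up to `R_{Σ₄}`» with NO S_H hypothesis (row 4, equivalence row), the squeeze
# `deĝ̲_lgp(P_Θ) − deĝ̲(P_q) ≤ δ + R_{Σ₄} + ((l+5)/4)·log π`, and the [ED]-stratum Σ₃ of row 3 (necessary row)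

abc-iut cell, rung LADDER-ABC:A2.RESCUE.H, R-H ROUND 2 seat abc-iut-rh2-q2-eq (rows 3/4/5); SEQUEL of `RHSigmaStrataEq.lean` (per-datum weakened
Cor. 3.12 from a Σ-restricted licence; Σ₄ = `sigmaNu` = the licence cells, `licenceOn_sigmaNu`, `statementUpTo_offRemainder_sigmaNu`) and of
`RHSigmaLicence.lean` (p468453: `LicenceOn`, `offRemainder`, `StatementUpTo`). Row 5 (tame-band licence on the tame/ball stratum) is
abc-iut-rh-typ-5's `RHTameBandLicence(Ball)` line, cited by name only.

§3 ROW 4 AT THE DATUM: **`GenuineK.cor312UpTo_sigmaNu`** — for every initial Θ-datum `D` over `K`, every genuine Θ-volume input `I` OF `D`, every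
context of abc-iut-c312-7's sharp print-normalised setting at `pilotDataOfK D K`, ALL realising ideles: `I.negAbsLogQ ≤ I.negLogTheta + R_{Σ₄}` with NO
S_H / H⋆ hypothesis (Θ-side = abc-iut-s2-p6's `negLogTheta_settingPrVolSharp_pilotDataOfK_le_genuine`, p447368 line); B-shift form
`GenuineK.negAbsLogQ_sub_offRemainder_sigmaNu_le`; the squeeze **`GenuineK.gap_le_of_hullEstimate_sigmaNu`** (∘ abc-iut-rh2-xi-1
`RH.OffSigma.input_gap_le_of_cor312UpTo`, p469145): with the hull estimate `δ`, `gap ≤ δ + R_{Σ₄} + ((l+5)/4)·log π`. For the equivalence row the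
whole of Q2 «S|Σ ⟹ weakened Cor 3.12 ⟹ abc-with-worse-constant» is thus the SIZE of `R_{Σ₄}(T)` against xi-1's `OffSigmaTolerance κ A T ·` (κ < 1).
§4 ROW 3: **`sigmaED`** = Σ₃ := the cells `(i, p)` all of whose bad places `x₀ | p` pass abc-iut-rh-typ-3's explicit-depth cell `CellAt` (p458118);
`hStar_iff_sigmaED_eq_univ`, `not_mem_sigmaED_of_not_cellAt`; the row-3 kernel target **`statementUpTo_offRemainder_of_licenceOn_sigmaED`** («S|Σ₃» is
a HYPOTHESIS: [ED] is necessary for a licence cell, not sufficient); `sigmaED_subset_sigmaNu_of_licenceOn` (if S|Σ₃ then Σ₃ ⊆ Σ₄ — a POS∧ν-REFUTED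
cell refutes S|Σ₃) and `offRemainder_sigmaNu_le_sigmaED_of_licenceOn`.
SEQUEL `RHSigmaStrataEqGenuine.lean` (genuine `K`-level datum, realising ideles): the NECESSITY side of row 3 — coarse (`sigmaED_eq_univ_of_licence`,
typ-3's `hStar_of_licence`) and PER CELL through abc-iut-rh-typ-3's round-2 `RHHullCapacityNecessaryCell.cellAt_of_cell` (Σ₄ ⊆ Σ₃, `R_{Σ₃} ≤ R_{Σ₄}`
unconditionally, «S|Σ₃» ⟺ Σ₃ = Σ₄) — and ROW 5 read in Σ₄-currency (uniformly tame data: Σ₄ = univ ⟺ abc-iut-rh-typ-5's H⋆₅).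

HONEST FRAMING: statements about OUR typed objects; nothing here asserts that abc is proved or refuted, or that [IUTchIII] Cor. 3.12 holds or fails at
any datum, or takes a side on any author (Mochizuki / Scholze–Stix / Joshi / Dupuy–Hilado); `R_{Σ₄}` is DEFINED and threaded, not bounded; typed ≠
proved; instantiated ≠ endorsed; refuted-as-typed ≠ refuted-in-print. [claim: Mochizuki2012, status: disputed] for every IUT locution.
[cite: Mochizuki2012, IUTchIII Cor. 3.12 p. 173–174, Step (xi-f) p. 184; IUTchI Ex. 3.2 (iv) p. 71; IUTchIV Thm. 1.10 Steps (v)–(x) p. 27–32]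
[cite: DupuyHilado2025, §3.9, §4.12] [cite: ScholzeStix2018, §2.2 pp. 9–10]
-/

noncomputable section

open Set Function NumberField IsDedekindDomain
open scoped Pointwise

namespace Summit.ABC.IUTFork.Repair.RH.SigmaStrataEq

open Summit.ABC.IUTFork.Thm311 Summit.ABC.IUTFork.Thm311.Real Summit.ABC.IUTFork.Cor312 Summit.ABC.IUTFork.Cor312.Setting
  Summit.ABC.IUTFork.Cor312Vol Summit.ABC.IUTFork.Cor312Prov Literature.IUT.LogThetaLattice Literature.IUT.LogVolume
  Literature.IUT.HodgeTheaters Literature.IUT.LogVolume.ThetaData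
  Summit.ABC.IUTFork.Repair.RH.SigmaLicence Summit.ABC.IUTFork.Repair.RH.HullThresholdExact
  Summit.ABC.IUTFork.Repair.RHHullCapacityNecessaryTyped

/-! ## §3. ROW 4 AT THE GENUINE `K`-LEVEL DATUM: Cor. 3.12 up to `R_{Σ₄}` with NO S_H hypothesis (all realising ideles) -/

section RowFourDatum

variable {F K Fbar : Type} [Field F] [NumberField F] [Field K] [NumberField K] [Algebra F K] [Field Fbar]
  [Algebra F Fbar] [Algebra K Fbar] {E : WeierstrassCurve F} [E.IsElliptic] {l : ℕ} {Pb : BadPlacePredicates K}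
  (D : InitialThetaData F K Fbar E l Pb) {I : ThetaVolumeInput (fieldOfModuli E) K}
  (M : Type) [Field M] [NumberField M]
  (archPk : ∀ (j : (thetaIndex (pilotDataOfK D K)).Label) (vQ : (thetaIndex (pilotDataOfK D K)).VQ),
    Set ((logShellsDH (pilotDataOfK D K) (analyticLogv K)).Packet j vQ))
  (archSub : ∀ (j : (thetaIndex (pilotDataOfK D K)).Label) (v : (thetaIndex (pilotDataOfK D K)).V),
    Set ((logShellsDH (pilotDataOfK D K) (analyticLogv K)).Packet j ((thetaIndex (pilotDataOfK D K)).over v)))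
  (Ψ : ℤ → ∀ v : (thetaIndex (pilotDataOfK D K)).V, v ∈ (thetaIndex (pilotDataOfK D K)).Vbad →
    Set ((logShellsDH (pilotDataOfK D K) (analyticLogv K)).StarPacket v))
  (act : ℤ → ∀ v : (thetaIndex (pilotDataOfK D K)).V, v ∈ (thetaIndex (pilotDataOfK D K)).Vbad →
    (logShellsDH (pilotDataOfK D K) (analyticLogv K)).StarPacket v →
      Module.End ℚ ((logShellsDH (pilotDataOfK D K) (analyticLogv K)).StarPacket v))
  (Mmod : ℤ → ∀ j : (thetaIndex (pilotDataOfK D K)).LabelStar,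
    Set ((logShellsDH (pilotDataOfK D K) (analyticLogv K)).GlobalPacket j.1))
  (region : ℤ → ∀ j : (thetaIndex (pilotDataOfK D K)).LabelStar, FinDivisor M → ∀ vQ : (thetaIndex (pilotDataOfK D K)).VQ,
    Set ((logShellsDH (pilotDataOfK D K) (analyticLogv K)).Packet j.1 vQ))
  (n : ℤ) {HT : Type} {LogLink : HT → HT → Type} {IsFull : ∀ {s t : HT}, LogLink s t → Prop}
  (lat : LGPGaussianLogThetaLattice LogLink IsFull)
  {Frd : Type} {IsoF : Frd → Frd → Type} {Ob : Frd → Type} {realify : Frd → Frd} {Strip : Type}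
  {IsoS : Strip → Strip → Type}
  {Mv : ∀ v : (thetaIndex (pilotDataOfK D K)).V, v ∈ (thetaIndex (pilotDataOfK D K)).Vbad → Type} [∀ v h, Monoid (Mv v h)]
  (sig : GlobalLGPFrobenioidSignature (thetaIndex (pilotDataOfK D K)).lstar (thetaIndex (pilotDataOfK D K)).V
    (· ∈ (thetaIndex (pilotDataOfK D K)).Vbad) Frd IsoF Ob realify Strip IsoS Mv)
  (split : SplittingMonoids Mv) {ObΔ : Type}
  {N : ∀ v : (thetaIndex (pilotDataOfK D K)).V, v ∈ (thetaIndex (pilotDataOfK D K)).Vbad → Type} [∀ v h, Monoid (N v h)]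
  (qData : QPilotData ObΔ N)
  (tq : ∀ (pp : Nat.Primes) (x : (thetaIndex (pilotDataOfK D K)).Fibre (.inr pp)),
    haveI : Fact (pp : ℕ).Prime := ⟨pp.2⟩; kOf (pilotDataOfK D K) pp.1 x)
  (t : ∀ (pp : Nat.Primes) (_ : Fin (pilotDataOfK D K).lstar) (x : (thetaIndex (pilotDataOfK D K)).Fibre (.inr pp)),
    haveI : Fact (pp : ℕ).Prime := ⟨pp.2⟩; kOf (pilotDataOfK D K) pp.1 x)
  (htq0 : ∀ pp x, tq pp x ≠ 0)
  (htq1 : ∀ (pp : Nat.Primes) (x : (thetaIndex (pilotDataOfK D K)).Fibre (.inr pp)),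
    haveI : Fact (pp : ℕ).Prime := ⟨pp.2⟩; placeOf (pilotDataOfK D K) pp.1 x ∉ (pilotDataOfK D K).S → ‖tq pp x‖ = 1)

/-- **ROW 4 AT THE DATUM, HYPOTHESIS-FREE: «Cor. 3.12 up to `R_{Σ₄}`» for every genuine Θ-volume input OF `D`.** At the genuine `K`-level pilot
datum `pilotDataOfK D K`, for EVERY context of abc-iut-c312-7's sharp print-normalised setting and ALL realising ideles (`ht0 ht1 htq hT`; inhabited
by `Cor312Prov.exists_realising_{q,theta}Ideles_pilotDataOfK`): `I.negAbsLogQ ≤ I.negLogTheta + R_{Σ₄}` — NO S_H, NO H⋆: the licence on Σ₄ is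
the theorem `licenceOn_sigmaNu`, the Θ-side is abc-iut-s2-p6's `negLogTheta_settingPrVolSharp_pilotDataOfK_le_genuine` (p447368 line). For the
equivalence row 4 the ENTIRE weight of «S|Σ ⟹ weakened Cor 3.12 ⟹ abc-with-worse-constant» is therefore the SIZE of `R_{Σ₄}` at the datum
(Q1's E_off⁺(Σ₄), rh2-xi-1 XI-EF-READING §C; tolerance = `RH.OffSigma.OffSigmaTolerance`). «holds AS TYPED for OUR hull»; no side taken.
[cite: Mochizuki2012, IUTchIII Cor. 3.12 p. 173–174; IUTchI Ex. 3.2 (iv) p. 71] [claim: Mochizuki2012, status: disputed] -/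
theorem GenuineK.cor312UpTo_sigmaNu (hI : ThetaData.IsVolumeInputOf D I) (ht0 : ∀ pp i x, t pp i x ≠ 0)
    (ht1 : ∀ (pp : Nat.Primes) (i : Fin (pilotDataOfK D K).lstar) (x : (thetaIndex (pilotDataOfK D K)).Fibre (.inr pp)),
      haveI : Fact (pp : ℕ).Prime := ⟨pp.2⟩; placeOf (pilotDataOfK D K) pp.1 x ∉ (pilotDataOfK D K).S → ‖t pp i x‖ = 1)
    (htq : ∀ (pp : Nat.Primes) (x : (thetaIndex (pilotDataOfK D K)).Fibre (.inr pp)),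
      haveI : Fact (pp : ℕ).Prime := ⟨pp.2⟩
      Real.log ‖tq pp x‖ = -((pilotDataOfK D K).qPilot (placeOf (pilotDataOfK D K) pp.1 x)) *
        logNorm K (placeOf (pilotDataOfK D K) pp.1 x) / localDegree K (placeOf (pilotDataOfK D K) pp.1 x))
    (hT : ∀ (pp : Nat.Primes) (i : Fin (pilotDataOfK D K).lstar) (x : (thetaIndex (pilotDataOfK D K)).Fibre (.inr pp)),
      haveI : Fact (pp : ℕ).Prime := ⟨pp.2⟩
      Real.log ‖t pp i x‖ = -((pilotDataOfK D K).thetaPilot i (placeOf (pilotDataOfK D K) pp.1 x)) *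
        logNorm K (placeOf (pilotDataOfK D K) pp.1 x) / localDegree K (placeOf (pilotDataOfK D K) pp.1 x)) :
    I.negAbsLogQ ≤ I.negLogTheta +
      offRemainder
        (settingPrVolSharp (pilotDataOfK D K) (logvAnalytic_analyticLogv (F := K)) M archPk archSub Ψ act Mmod region n lat sig split
          qData tq t htq0 htq1)
        (sigmaNu (pilotDataOfK D K) (logvAnalytic_analyticLogv (F := K)) M archPk archSub Ψ act Mmod region n lat sig split qData tq t
          htq0 htq1) :=
  GenuineK.cor312UpTo_of_licenceOn D K M archPk archSub Ψ act Mmod region n lat sig split qData t tq hI htq0 htq1 ht0 ht1 htq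
    (licenceOn_sigmaNu (pilotDataOfK D K) (logvAnalytic_analyticLogv (F := K)) M archPk archSub Ψ act Mmod region n lat sig split qData
      tq t htq0 htq1 ht0)
    (negLogTheta_settingPrVolSharp_pilotDataOfK_le_genuine D M archPk archSub Ψ act Mmod region n lat sig split qData tq t htq0 htq1 ht0
      hT hI)

/-- The same in abc-iut-rh2-xi-1's B-shift currency: `I.negAbsLogQ − R_{Σ₄} ≤ I.negLogTheta` — the hypothesis `h1` of
`RH.OffSigma.input_gap_le_of_cor312UpTo` / `gap_le_of_cor312UpTo` with `B := R_{Σ₄}`. [claim: Mochizuki2012, status: disputed] -/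
theorem GenuineK.negAbsLogQ_sub_offRemainder_sigmaNu_le (hI : ThetaData.IsVolumeInputOf D I) (ht0 : ∀ pp i x, t pp i x ≠ 0)
    (ht1 : ∀ (pp : Nat.Primes) (i : Fin (pilotDataOfK D K).lstar) (x : (thetaIndex (pilotDataOfK D K)).Fibre (.inr pp)),
      haveI : Fact (pp : ℕ).Prime := ⟨pp.2⟩; placeOf (pilotDataOfK D K) pp.1 x ∉ (pilotDataOfK D K).S → ‖t pp i x‖ = 1)
    (htq : ∀ (pp : Nat.Primes) (x : (thetaIndex (pilotDataOfK D K)).Fibre (.inr pp)),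
      haveI : Fact (pp : ℕ).Prime := ⟨pp.2⟩
      Real.log ‖tq pp x‖ = -((pilotDataOfK D K).qPilot (placeOf (pilotDataOfK D K) pp.1 x)) *
        logNorm K (placeOf (pilotDataOfK D K) pp.1 x) / localDegree K (placeOf (pilotDataOfK D K) pp.1 x))
    (hT : ∀ (pp : Nat.Primes) (i : Fin (pilotDataOfK D K).lstar) (x : (thetaIndex (pilotDataOfK D K)).Fibre (.inr pp)),
      haveI : Fact (pp : ℕ).Prime := ⟨pp.2⟩
      Real.log ‖t pp i x‖ = -((pilotDataOfK D K).thetaPilot i (placeOf (pilotDataOfK D K) pp.1 x)) *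
        logNorm K (placeOf (pilotDataOfK D K) pp.1 x) / localDegree K (placeOf (pilotDataOfK D K) pp.1 x)) :
    I.negAbsLogQ -
        offRemainder
          (settingPrVolSharp (pilotDataOfK D K) (logvAnalytic_analyticLogv (F := K)) M archPk archSub Ψ act Mmod region n lat sig split
            qData tq t htq0 htq1)
          (sigmaNu (pilotDataOfK D K) (logvAnalytic_analyticLogv (F := K)) M archPk archSub Ψ act Mmod region n lat sig split qData tq t
            htq0 htq1) ≤
      I.negLogTheta :=
  sub_le_iff_le_add.mpr
    (GenuineK.cor312UpTo_sigmaNu D M archPk archSub Ψ act Mmod region n lat sig split qData tq t htq0 htq1 hI ht0 ht1 htq hT)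

/-- **ROW 4 SQUEEZE at the genuine input, hypothesis-free on the S_H side**: with the hull estimate `I.HullEstimateOf δ` ([IUTchIV] Thm. 1.10
Steps (v)–(viii)), `deĝ̲_lgp(P_Θ) − deĝ̲(P_q) ≤ δ + R_{Σ₄} + ((l+5)/4)·log π` (abc-iut-rh2-xi-1 `input_gap_le_of_cor312UpTo`, p469145). Whether
abc follows is exactly whether `R_{Σ₄}` fits the tolerance `RH.OffSigma.OffSigmaTolerance κ A · (R_{Σ₄})` with `κ < 1`.
[cite: Mochizuki2012, IUTchIV Thm. 1.10 Steps (viii)–(x) p. 30–32] [claim: Mochizuki2012, status: disputed] -/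
theorem GenuineK.gap_le_of_hullEstimate_sigmaNu (hI : ThetaData.IsVolumeInputOf D I) (ht0 : ∀ pp i x, t pp i x ≠ 0)
    (ht1 : ∀ (pp : Nat.Primes) (i : Fin (pilotDataOfK D K).lstar) (x : (thetaIndex (pilotDataOfK D K)).Fibre (.inr pp)),
      haveI : Fact (pp : ℕ).Prime := ⟨pp.2⟩; placeOf (pilotDataOfK D K) pp.1 x ∉ (pilotDataOfK D K).S → ‖t pp i x‖ = 1)
    (htq : ∀ (pp : Nat.Primes) (x : (thetaIndex (pilotDataOfK D K)).Fibre (.inr pp)),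
      haveI : Fact (pp : ℕ).Prime := ⟨pp.2⟩
      Real.log ‖tq pp x‖ = -((pilotDataOfK D K).qPilot (placeOf (pilotDataOfK D K) pp.1 x)) *
        logNorm K (placeOf (pilotDataOfK D K) pp.1 x) / localDegree K (placeOf (pilotDataOfK D K) pp.1 x))
    (hT : ∀ (pp : Nat.Primes) (i : Fin (pilotDataOfK D K).lstar) (x : (thetaIndex (pilotDataOfK D K)).Fibre (.inr pp)),
      haveI : Fact (pp : ℕ).Prime := ⟨pp.2⟩
      Real.log ‖t pp i x‖ = -((pilotDataOfK D K).thetaPilot i (placeOf (pilotDataOfK D K) pp.1 x)) *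
        logNorm K (placeOf (pilotDataOfK D K) pp.1 x) / localDegree K (placeOf (pilotDataOfK D K) pp.1 x))
    {δ : ℝ} (h2 : I.HullEstimateOf δ) :
    LgpDivisor.ndegLgp I.X.thetaPilot - FinDivisor.ndeg _ I.X.qPilot ≤
      δ + offRemainder
          (settingPrVolSharp (pilotDataOfK D K) (logvAnalytic_analyticLogv (F := K)) M archPk archSub Ψ act Mmod region n lat sig split
            qData tq t htq0 htq1)
          (sigmaNu (pilotDataOfK D K) (logvAnalytic_analyticLogv (F := K)) M archPk archSub Ψ act Mmod region n lat sig split qData tq t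
            htq0 htq1) + ThetaVolumeInput.archLogTheta I.l :=
  RH.OffSigma.input_gap_le_of_cor312UpTo I
    (GenuineK.negAbsLogQ_sub_offRemainder_sigmaNu_le D M archPk archSub Ψ act Mmod region n lat sig split qData tq t htq0 htq1 hI ht0 ht1
      htq hT) h2

end RowFourDatum

/-! ## §4. ROW 3: Σ₃ = the [ED]-cells of abc-iut-rh-typ-3's H⋆₃ (necessary side — «S restricted to Σ₃» stays a hypothesis) -/

section RowThree

variable {F : Type} [Field F] [NumberField F] (X : PilotData F) {logv : PadicLogs F} (hlog : LogvAnalytic logv)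

/-- **Σ₃ = `sigmaED`, the [ED]-STRATUM (row 3 «hull-capacity-necessary», the not-[ED]-refuted cells)**: the cells `(i, v_ℚ)` such that at every
prime `p` with `v_ℚ = p`, EVERY bad place `x₀ | p` passes abc-iut-rh-typ-3's explicit-depth cell `CellAt X hlog p i x₀` (p458118; R-W `margin_ED ≥ 0`).
Archimedean cells and good places: no condition. [claim: Mochizuki2012, status: disputed] -/
@[claim "Mochizuki2012" "disputed"]
def sigmaED : Set (Fin (thetaIndex X).lstar × (thetaIndex X).VQ) :=
  {c | ∀ pp : Nat.Primes, c.2 = .inr pp → ∀ x₀ : (thetaIndex X).Fibre (.inr pp),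
      (haveI : Fact (pp : ℕ).Prime := ⟨pp.2⟩; placeOf X pp.1 x₀ ∈ X.S) → CellAt X hlog pp c.1 x₀}

/-- abc-iut-rh-typ-3's H⋆₃ (`HStar`, every bad place, every label) ⟺ Σ₃ is everything. [claim: Mochizuki2012, status: disputed] -/
theorem hStar_iff_sigmaED_eq_univ : HStar X hlog ↔ sigmaED X hlog = Set.univ := by
  constructor
  · intro h
    exact Set.eq_univ_of_forall fun c pp _ x₀ hx => h pp x₀ hx c.1
  · intro h pp x₀ hx i₀
    have hc : ((i₀, Sum.inr pp) : Fin (thetaIndex X).lstar × (thetaIndex X).VQ) ∈ sigmaED X hlog := by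
      rw [h]; exact Set.mem_univ _
    exact hc pp rfl x₀ hx

/-- A failing [ED] cell at a bad place `x₀ | p` with label `i₀` expels `(i₀, p)` from Σ₃. [claim: Mochizuki2012, status: disputed] -/
theorem not_mem_sigmaED_of_not_cellAt (pp : Nat.Primes) (i₀ : Fin (thetaIndex X).lstar) (x₀ : (thetaIndex X).Fibre (.inr pp))
    (hx : haveI : Fact (pp : ℕ).Prime := ⟨pp.2⟩; placeOf X pp.1 x₀ ∈ X.S) (h : ¬ CellAt X hlog pp i₀ x₀) :
    ((i₀, Sum.inr pp) : Fin (thetaIndex X).lstar × (thetaIndex X).VQ) ∉ sigmaED X hlog :=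
  fun hc => h (hc pp rfl x₀ hx)

end RowThree

section RowThreeBed

variable {F : Type} [Field F] [NumberField F] (X : PilotData F) {logv : PadicLogs F} (hlog : LogvAnalytic logv)
  (M : Type) [Field M] [NumberField M]
  (archPk : ∀ (j : (thetaIndex X).Label) (vQ : (thetaIndex X).VQ), Set ((logShellsDH X logv).Packet j vQ))
  (archSub : ∀ (j : (thetaIndex X).Label) (v : (thetaIndex X).V),
    Set ((logShellsDH X logv).Packet j ((thetaIndex X).over v)))
  (Ψ : ℤ → ∀ v : (thetaIndex X).V, v ∈ (thetaIndex X).Vbad → Set ((logShellsDH X logv).StarPacket v))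
  (act : ℤ → ∀ v : (thetaIndex X).V, v ∈ (thetaIndex X).Vbad →
    (logShellsDH X logv).StarPacket v → Module.End ℚ ((logShellsDH X logv).StarPacket v))
  (Mmod : ℤ → ∀ j : (thetaIndex X).LabelStar, Set ((logShellsDH X logv).GlobalPacket j.1))
  (region : ℤ → ∀ j : (thetaIndex X).LabelStar, FinDivisor M → ∀ vQ : (thetaIndex X).VQ,
    Set ((logShellsDH X logv).Packet j.1 vQ))
  (n : ℤ) {HT : Type} {LogLink : HT → HT → Type} {IsFull : ∀ {s t : HT}, LogLink s t → Prop}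
  (lat : LGPGaussianLogThetaLattice LogLink IsFull)
  {Frd : Type} {IsoF : Frd → Frd → Type} {Ob : Frd → Type} {realify : Frd → Frd} {Strip : Type}
  {IsoS : Strip → Strip → Type} {Mv : ∀ v : (thetaIndex X).V, v ∈ (thetaIndex X).Vbad → Type}
  [∀ v h, Monoid (Mv v h)]
  (sig : GlobalLGPFrobenioidSignature (thetaIndex X).lstar (thetaIndex X).V (· ∈ (thetaIndex X).Vbad)
    Frd IsoF Ob realify Strip IsoS Mv)
  (split : SplittingMonoids Mv) {ObΔ : Type} {N : ∀ v : (thetaIndex X).V, v ∈ (thetaIndex X).Vbad → Type}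
  [∀ v h, Monoid (N v h)] (qData : QPilotData ObΔ N)
  (tq : ∀ (pp : Nat.Primes) (x : (thetaIndex X).Fibre (.inr pp)), haveI : Fact (pp : ℕ).Prime := ⟨pp.2⟩; kOf X pp.1 x)
  (t : ∀ (pp : Nat.Primes) (_ : Fin X.lstar) (x : (thetaIndex X).Fibre (.inr pp)),
    haveI : Fact (pp : ℕ).Prime := ⟨pp.2⟩; kOf X pp.1 x)
  (htq0 : ∀ pp x, tq pp x ≠ 0)
  (htq1 : ∀ (pp : Nat.Primes) (x : (thetaIndex X).Fibre (.inr pp)),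
    haveI : Fact (pp : ℕ).Prime := ⟨pp.2⟩; placeOf X pp.1 x ∉ X.S → ‖tq pp x‖ = 1)

/-- **ROW 3 KERNEL TARGET at the bed: «S restricted to Σ₃ ⟹ Cor. 3.12 up to `R_{Σ₃}`»** (ideles non-zero, units off `S`; the licence on Σ₃ is a
HYPOTHESIS — [ED] is necessary for a licence cell, not sufficient). [claim: Mochizuki2012, status: disputed] -/
theorem statementUpTo_offRemainder_of_licenceOn_sigmaED (ht0 : ∀ pp i x, t pp i x ≠ 0)
    (ht1 : ∀ (pp : Nat.Primes) (i : Fin X.lstar) (x : (thetaIndex X).Fibre (.inr pp)),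
      haveI : Fact (pp : ℕ).Prime := ⟨pp.2⟩; placeOf X pp.1 x ∉ X.S → ‖t pp i x‖ = 1)
    (hσ : LicenceOn (settingPrVolSharp X hlog M archPk archSub Ψ act Mmod region n lat sig split qData tq t htq0 htq1) (sigmaED X hlog)) :
    StatementUpTo (settingPrVolSharp X hlog M archPk archSub Ψ act Mmod region n lat sig split qData tq t htq0 htq1)
      (offRemainder (settingPrVolSharp X hlog M archPk archSub Ψ act Mmod region n lat sig split qData tq t htq0 htq1) (sigmaED X hlog)) :=
  statementUpTo_offRemainder_of_licenceOn
    (bridgeHyps_settingPrVolSharp_of_ideles X hlog M archPk archSub Ψ act Mmod region n lat sig split qData t tq ht0 ht1 htq0 htq1) hσ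

/-- **If the licence holds on Σ₃, then Σ₃ ⊆ Σ₄** (Σ₄ is the largest licence stratum) — so a POS∧REFUTED cell between the two strata (an
[ED]-passed cell whose ν-cell fails) REFUTES «S restricted to Σ₃» at that bed. [claim: Mochizuki2012, status: disputed] -/
theorem sigmaED_subset_sigmaNu_of_licenceOn (ht0 : ∀ pp i x, t pp i x ≠ 0)
    (hσ : LicenceOn (settingPrVolSharp X hlog M archPk archSub Ψ act Mmod region n lat sig split qData tq t htq0 htq1) (sigmaED X hlog)) :
    sigmaED X hlog ⊆ sigmaNu X hlog M archPk archSub Ψ act Mmod region n lat sig split qData tq t htq0 htq1 :=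
  subset_sigmaNu_of_licenceOn X hlog M archPk archSub Ψ act Mmod region n lat sig split qData tq t htq0 htq1 ht0 hσ

/-- … and then `R_{Σ₄} ≤ R_{Σ₃}`-free comparison the other way: the hypothesis-free charge `R_{Σ₄}` never exceeds row 3's `R_{Σ₃}` under «S|Σ₃».
[claim: Mochizuki2012, status: disputed] -/
theorem offRemainder_sigmaNu_le_sigmaED_of_licenceOn (ht0 : ∀ pp i x, t pp i x ≠ 0)
    (ht1 : ∀ (pp : Nat.Primes) (i : Fin X.lstar) (x : (thetaIndex X).Fibre (.inr pp)),
      haveI : Fact (pp : ℕ).Prime := ⟨pp.2⟩; placeOf X pp.1 x ∉ X.S → ‖t pp i x‖ = 1)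
    (hσ : LicenceOn (settingPrVolSharp X hlog M archPk archSub Ψ act Mmod region n lat sig split qData tq t htq0 htq1) (sigmaED X hlog)) :
    offRemainder (settingPrVolSharp X hlog M archPk archSub Ψ act Mmod region n lat sig split qData tq t htq0 htq1)
        (sigmaNu X hlog M archPk archSub Ψ act Mmod region n lat sig split qData tq t htq0 htq1) ≤
      offRemainder (settingPrVolSharp X hlog M archPk archSub Ψ act Mmod region n lat sig split qData tq t htq0 htq1) (sigmaED X hlog) :=
  offRemainder_sigmaNu_le X hlog M archPk archSub Ψ act Mmod region n lat sig split qData tq t htq0 htq1 ht0 ht1 hσ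

end RowThreeBed

end Summit.ABC.IUTFork.Repair.RH.SigmaStrataEq

end
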